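import Mathlib.Analysis.Fourier.FourierTransform
import Literature.MathematicalPhysics.StatisticalMechanics.BarlowStacking
import Summits.AtomisticToContinuum.Crystallization.Theorems.SlackRigidity.Negative.WitnessBasics
import HarnessLib

/-!
# Rod objects of line `signed-root-silent-field` — definitions
(crux `SlackRigidity`, stmt-AtomisticToContinuum-11960, route `ThreeConeCertificate`)

The line selects hcp among all Barlow stackings `barlowStacking a h s` by SILENCE of the smeared
Bochner field `Φ_X(y) = Σ_{q ∈ X} K(|y − q|)` of the certificate's signed root `K` (`f = K ⋆ K`).
Layer `k` of the stacking is the triangular lattice `ℤu + ℤv` (`u = (a,0,0)`, `v = (a/2, a√3/2, 0)`)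
shifted by `L_k w` (`w = barlowOffset a`, `L_k = haggLabel s k`) in the plane `x₃ = kh`; its
contribution to the `G`-th planar Fourier coefficient of `Φ_X` on the section `x₃ = t` is
`ω^{L_k} · c_G(t − kh)` for the CLASS-1 dual vector `G = (1/a, −1/(a√3))` (`⟨G,u⟩ = 1`, `⟨G,v⟩ = 0`,
`⟨G,w⟩ = 1/3`, `|G|² = 4/(3a²)`), `ω = e^{−2πi/3}`.  This file only DEFINES the three objects the
registered stubs of the line share (D-0016: definitions are reviewed; every property is proved in
the sibling proof files):

* `rodDual a : ℝ²` — the planar dual vector `G`;  `rodPoint a ξ₃ : ℝ³` — the point `(G, ξ₃)` of the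
  `(10)` reciprocal rod;
* `rodProfile a K t = 𝓕₂ (u ↦ K(√(|u|² + t²))) (rodDual a)` — the ROD PROFILE `c_G(t)` (planar Fourier
  transform, Mathlib's `𝓕` on `EuclideanSpace ℝ (Fin 2)`, convention `e^{−2πi⟨u,ξ⟩}`);
* `rodPhase s k = e^{−2πi L_k / 3}` — the LAYER PHASE `ω^{L_k}`.

All `[folklore]` (Cohn–Kumar 2006 §9, Poisson summation with structure factor; Conway–Sloane Ch. 4,
hcp reciprocal set).
-/

noncomputable section

namespace Summit.AtomisticToContinuum.Crystallization.Theorems.SignedRootSilentField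

open scoped FourierTransform
open Literature.MathematicalPhysics.StatisticalMechanics
open Summit.AtomisticToContinuum.Crystallization.Theorems.SlackRigidityNegative (E3)

/-- The Euclidean plane (the layer plane `x₃ = const` in its own coordinates). [folklore] -/
abbrev E2 := EuclideanSpace ℝ (Fin 2)

/-- The CLASS-1 DUAL VECTOR `G = (1/a, −1/(a√3))` of the triangular layer lattice `ℤ(a,0) + ℤ(a/2, a√3/2)`:
`⟨G, (a,0)⟩ = 1`, `⟨G, (a/2, a√3/2)⟩ = 0`, `⟨G, (a/2, a√3/6)⟩ = 1/3`, `|G|² = 4/(3a²)`. [folklore] -/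
def rodDual (a : ℝ) : E2 := !₂[1 / a, -1 / (a * Real.sqrt 3)]

/-- The point `(G, ξ₃) = (1/a, −1/(a√3), ξ₃)` of the `(10)` reciprocal rod over `G = rodDual a`, at
height `ξ₃`; `|rodPoint a ξ₃|² = 4/(3a²) + ξ₃²`. [folklore] -/
def rodPoint (a ξ₃ : ℝ) : E3 := !₂[1 / a, -1 / (a * Real.sqrt 3), ξ₃]

/-- The ROD PROFILE `c_G(t) = ∫_{ℝ²} K(√(|u|² + t²)) e^{−2πi⟨u,G⟩} du` of a radial kernel profile
`K : ℝ → ℝ` at the class-1 dual vector `G = rodDual a`: the planar Fourier transform (Mathlib `𝓕` on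
`ℝ²`) of the restriction of `y ↦ K(|y|)` to the section `x₃ = t`, evaluated at `G`.  Its 1-D Fourier
transform in `t` is the restriction of `𝓕₃ (K ∘ |·|)` to the rod `ξ ↦ rodPoint a ξ` (Fourier slice).
[folklore] -/
def rodProfile (a : ℝ) (K : ℝ → ℝ) (t : ℝ) : ℂ :=
  𝓕 (fun u : E2 => (K (Real.sqrt (‖u‖ ^ 2 + t ^ 2)) : ℂ)) (rodDual a)

/-- The LAYER PHASE `ω^{L_k} = e^{−2πi L_k/3}` of layer `k` of the Barlow stacking coded by `s`
(`L_k = haggLabel s k`; `ω = e^{−2πi/3}` is `e^{−2πi⟨w, G⟩}` for the letter offset `w = barlowOffset a`). [folklore] -/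
def rodPhase (s : ℤ → ℤ) (k : ℤ) : ℂ :=
  Complex.exp (-(2 * Real.pi * Complex.I) * (haggLabel s k : ℂ) / 3)

/-- Unfolding lemma for `rodProfile`. [folklore] -/
theorem rodProfile_def (a : ℝ) (K : ℝ → ℝ) (t : ℝ) :
    rodProfile a K t = 𝓕 (fun u : E2 => (K (Real.sqrt (‖u‖ ^ 2 + t ^ 2)) : ℂ)) (rodDual a) := rfl

/-- Unfolding lemma for `rodPhase`. [folklore] -/
theorem rodPhase_def (s : ℤ → ℤ) (k : ℤ) :
    rodPhase s k = Complex.exp (-(2 * Real.pi * Complex.I) * (haggLabel s k : ℂ) / 3) := rfl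

/-- The layer phase is unimodular (anchor theorem of this definitions file). [folklore] -/
theorem norm_rodPhase : ∀ (s : ℤ → ℤ) (k : ℤ), ‖rodPhase s k‖ = 1 := by
  intro s k
  rw [rodPhase, Complex.norm_exp]
  have : (-(2 * (Real.pi : ℂ) * Complex.I) * (haggLabel s k : ℂ) / 3).re = 0 := by
    simp
  rw [this, Real.exp_zero]

/-- Coordinates of `rodPoint`. [folklore] -/
@[simp] theorem rodPoint_apply_zero (a ξ₃ : ℝ) : rodPoint a ξ₃ 0 = 1 / a := by
  simp [rodPoint]

/-- Coordinates of `rodPoint`. [folklore] -/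
@[simp] theorem rodPoint_apply_one (a ξ₃ : ℝ) : rodPoint a ξ₃ 1 = -1 / (a * Real.sqrt 3) := by
  simp [rodPoint]

/-- Coordinates of `rodPoint`. [folklore] -/
@[simp] theorem rodPoint_apply_two (a ξ₃ : ℝ) : rodPoint a ξ₃ 2 = ξ₃ := by
  simp [rodPoint]

/-- Coordinates of `rodDual`. [folklore] -/
@[simp] theorem rodDual_apply_zero (a : ℝ) : rodDual a 0 = 1 / a := by
  simp [rodDual]

/-- Coordinates of `rodDual`. [folklore] -/
@[simp] theorem rodDual_apply_one (a : ℝ) : rodDual a 1 = -1 / (a * Real.sqrt 3) := by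
  simp [rodDual]

/-- `|rodPoint a ξ₃|² = 4/(3a²) + ξ₃²` (for `a ≠ 0`). [folklore] -/
theorem norm_rodPoint_sq {a : ℝ} (ha : a ≠ 0) (ξ₃ : ℝ) :
    ‖rodPoint a ξ₃‖ ^ 2 = 4 / (3 * a ^ 2) + ξ₃ ^ 2 := by
  rw [EuclideanSpace.norm_eq, Real.sq_sqrt (Finset.sum_nonneg fun i _ => sq_nonneg _),
    Fin.sum_univ_three]
  simp only [rodPoint_apply_zero, rodPoint_apply_one, rodPoint_apply_two, Real.norm_eq_abs, sq_abs]
  have h3 : Real.sqrt 3 ^ 2 = 3 := Real.sq_sqrt (by norm_num)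
  field_simp
  rw [h3]
  ring

end Summit.AtomisticToContinuum.Crystallization.Theorems.SignedRootSilentField

end
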